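import Literature.NumberTheory.LFunctions.WeilMarkovQuadratic
import Literature.NumberTheory.LFunctions.WeilGroundState
import Literature.NumberTheory.LFunctions.WeilGroundStateRealZerosProofs
import Literature.NumberTheory.LFunctions.WeilWindowSuzukiProofs
import Literature.NumberTheory.LFunctions.WeilSemilocalCompactnessProofs
import Summits.RiemannHypothesis.RiemannHypothesis.Theorems.WeilWindowFlowWindowLipschitzStubSupBoundAux
import Summits.RiemannHypothesis.RiemannHypothesis.Theorems.WeilWindowFlowWindowLipschitzStubLocalizedCutAux2

/-!
# Auxiliary file for sub-stub `stub_edgeLaw_comparison` (P3 of stub `stub_edgeLaw`, line `cut-dont-squeeze`,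
crux `WeilWindowFlow.WindowLipschitz`, item stmt-RiemannHypothesis-1039)

The one-phase weak maximum principle with a barrier, `stub_edgeLaw_comparison_phase`: under finite
energy (C2) and the weak Euler–Lagrange identity (EL), for a ground state `v` of the window
`a ∈ [b₀, A]` with `‖v‖ ≤ K₀` and a barrier `B` (`0 ≤ B ≤ T⁻¹`, `= T⁻¹` on the plateau, `= 0` off
the window, finite energy, surplus `σ` against non-negative layer functions), testing (EL) against
`W = (Re v − K₀ T B)⁺` (which lives in the edge layer) and taking real parts gives
`(K₀Tσ − 2K₀S_A − 4e^{2A}(A+½) − 2ρ(δ)(A+½)) ∫W ≤ (M_a + ε(a) − κ_δ) ∫ Re v · W ≤ 0`, so `W = 0` a.e.: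
the `δ`-decomposition maximum principle of Feulefack–Jarohs–Weth (arXiv:2010.10448 §3) with the
barrier comparison of Hernández-Santamaría–López-Ríos–Saldaña (arXiv:2401.18033, Thm 1.1 / 2.4);
and the barrier pairing bound `∫ (B(x+t) − B x)(W(x+t) − W x) ≥ −2β ∫ W`.
-/

set_option linter.dupNamespace false

noncomputable section

open MeasureTheory Set Filter
open scoped Topology ENNReal NNReal ComplexConjugate

namespace Summit.RiemannHypothesis.RiemannHypothesis.Theorems.WeilWindowFlowWindowLipschitz

open Literature.NumberTheory.LFunctions

/-- The truncation `z ↦ ((Re z)⁺ : ℂ)` is `1`-Lipschitz. [folklore] -/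
private theorem stub_edgeLaw_comparison_trunc :
    LipschitzWith 1 (fun z : ℂ ↦ ((max z.re 0 : ℝ) : ℂ)) := by
  refine LipschitzWith.of_dist_le_mul fun z w ↦ ?_
  rw [NNReal.coe_one, one_mul, Complex.dist_eq, ← Complex.ofReal_sub, Complex.norm_real,
    Real.norm_eq_abs, Complex.dist_eq]
  calc |max z.re 0 - max w.re 0| ≤ |z.re - w.re| := abs_max_sub_max_le_abs _ _ _
    _ = |(z - w).re| := by rw [Complex.sub_re]
    _ ≤ ‖z - w‖ := Complex.abs_re_le_norm _

/-- **Markov inequality** for the positive part: `(p − q)(p⁺ − q⁺) ≥ 0`. [folklore] -/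
private theorem stub_edgeLaw_comparison_markov (p q : ℝ) :
    0 ≤ (p - q) * (max p 0 - max q 0) := by
  rcases le_total q p with h | h
  · exact mul_nonneg (sub_nonneg.2 h) (sub_nonneg.2 (max_le_max h le_rfl))
  · exact mul_nonneg_of_nonpos_of_nonpos (sub_nonpos.2 h) (sub_nonpos.2 (max_le_max h le_rfl))

/-- `D_t(c f) = c² D_t(f)` for a real constant `c`. [folklore] -/
private theorem stub_edgeLaw_comparison_incr_const_mul (c : ℝ) (f : ℝ → ℂ) (t : ℝ) :
    weilIncrement (fun x ↦ (c : ℂ) * f x) t = c ^ 2 * weilIncrement f t := by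
  unfold weilIncrement
  rw [← integral_const_mul]
  refine integral_congr_ae (Eventually.of_forall fun x ↦ ?_)
  simp only
  rw [← mul_sub, norm_mul, mul_pow, Complex.norm_real, Real.norm_eq_abs, sq_abs]

/-- **The barrier pairing is bounded below**: for `0 ≤ B ≤ β`, `W ≥ 0` (`B, W ∈ L²`, `W ∈ L¹`),
`∫ (B(x+t) − B x)(W(x+t) − W x) dx ≥ −2β ∫ W` (expand; `∫ B W ≥ 0`, `∫ W(x) B(x+t) ≤ β∫W`).
[folklore] -/
theorem stub_edgeLaw_comparison_cross_lower :
    ∀ {B W : ℝ → ℝ} {β : ℝ}, MemLp B 2 → MemLp W 2 → Integrable W → (∀ x, 0 ≤ B x) →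
      (∀ x, B x ≤ β) → (∀ x, 0 ≤ W x) → ∀ t : ℝ,
        -(2 * β * ∫ x, W x) ≤ ∫ x, (B (x + t) - B x) * (W (x + t) - W x) := by
  intro B W β hB hW hW1 hB0 hBβ hW0 t
  rw [stub_supBound_crossIncrement_expand hB hW t]
  have hBt : MemLp (fun x ↦ B (x + t)) 2 :=
    hB.comp_measurePreserving (measurePreserving_add_right volume t)
  have hWt : MemLp (fun x ↦ W (x + t)) 2 :=
    hW.comp_measurePreserving (measurePreserving_add_right volume t)
  have h1 : 0 ≤ ∫ x, B x * W x := integral_nonneg fun x ↦ mul_nonneg (hB0 x) (hW0 x)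
  have h2 : ∫ x, W x * B (x + t) ≤ β * ∫ x, W x := by
    rw [← integral_const_mul]
    refine integral_mono (hW.integrable_mul hBt) (hW1.const_mul β) fun x ↦ ?_
    show W x * B (x + t) ≤ β * W x
    rw [mul_comm β]
    exact mul_le_mul_of_nonneg_left (hBβ _) (hW0 x)
  have h3 : ∫ x, B x * W (x + t) ≤ β * ∫ x, W x := by
    have e : ∫ x, W (x + t) = ∫ x, W x := integral_add_right_eq_self W t
    calc ∫ x, B x * W (x + t) ≤ ∫ x, β * W (x + t) :=
          integral_mono (hB.integrable_mul hWt) ((hW1.comp_add_right t).const_mul β) fun x ↦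
            mul_le_mul_of_nonneg_right (hBβ x) (hW0 _)
      _ = β * ∫ x, W x := by rw [integral_const_mul, e]
  linarith

/-- **The pole term is `O_A(‖u‖₁ ‖W‖₁)`**: for `u`, `W` vanishing off `[-a, a] ⊆ [-A, A]`,
`Re[2(∫u ch)conj(∫W ch)] − Re[2(∫u sh)conj(∫W sh)] ≥ −4e^{2A}‖u‖₁‖W‖₁`
(adapted from `stub_supBound`). [folklore] -/
private theorem stub_edgeLaw_comparison_pole {u : ℝ → ℂ} {W : ℝ → ℝ} {a A : ℝ} (haA : a ≤ A)
    (hu1 : Integrable u) (hu0 : ∀ x, x ∉ Icc (-a) a → u x = 0)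
    (hW1 : Integrable (fun x ↦ (W x : ℂ))) (hW0 : ∀ x, x ∉ Icc (-a) a → W x = 0) :
    -(4 * Real.exp A ^ 2 * (∫ x, ‖u x‖) * ∫ x, ‖(W x : ℂ)‖) ≤
      (2 * (∫ x, u x * (Real.cosh (x / 2) : ℂ)) *
          conj (∫ x, (W x : ℂ) * (Real.cosh (x / 2) : ℂ))).re -
      (2 * (∫ x, u x * (Real.sinh (x / 2) : ℂ)) *
          conj (∫ x, (W x : ℂ) * (Real.sinh (x / 2) : ℂ))).re := by
  have hWC0 : ∀ x, x ∉ Icc (-a) a → (W x : ℂ) = 0 := fun x hx ↦ by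
    rw [hW0 x hx, Complex.ofReal_zero]
  have b1 := stub_supBound_norm_integral_mul_le hu1 hu0
    (fun x hx ↦ (stub_supBound_cosh_sinh_le haA hx).1)
  have b2 := stub_supBound_norm_integral_mul_le hW1 hWC0
    (fun x hx ↦ (stub_supBound_cosh_sinh_le haA hx).1)
  have b3 := stub_supBound_norm_integral_mul_le hu1 hu0
    (fun x hx ↦ (stub_supBound_cosh_sinh_le haA hx).2)
  have b4 := stub_supBound_norm_integral_mul_le hW1 hWC0
    (fun x hx ↦ (stub_supBound_cosh_sinh_le haA hx).2)
  have hNu : 0 ≤ ∫ x, ‖u x‖ := integral_nonneg fun _ ↦ norm_nonneg _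
  have key : ∀ I₁ I₂ : ℂ, ‖I₁‖ ≤ Real.exp A * ∫ x, ‖u x‖ → ‖I₂‖ ≤ Real.exp A * ∫ x, ‖(W x : ℂ)‖ →
      |(2 * I₁ * conj I₂).re| ≤ 2 * Real.exp A ^ 2 * (∫ x, ‖u x‖) * ∫ x, ‖(W x : ℂ)‖ := by
    intro I₁ I₂ h1 h2
    calc |(2 * I₁ * conj I₂).re| ≤ ‖2 * I₁ * conj I₂‖ := Complex.abs_re_le_norm _
      _ = 2 * (‖I₁‖ * ‖I₂‖) := by
          rw [norm_mul, norm_mul, Complex.norm_conj, Complex.norm_two]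
          ring
      _ ≤ 2 * ((Real.exp A * ∫ x, ‖u x‖) * (Real.exp A * ∫ x, ‖(W x : ℂ)‖)) :=
          mul_le_mul_of_nonneg_left (mul_le_mul h1 h2 (norm_nonneg _)
            (mul_nonneg (Real.exp_pos A).le hNu)) two_pos.le
      _ = 2 * Real.exp A ^ 2 * (∫ x, ‖u x‖) * ∫ x, ‖(W x : ℂ)‖ := by ring
  have k1 := key _ _ b1 b2
  have k2 := key _ _ b3 b4
  rw [abs_le] at k1 k2
  linarith [k1.1, k2.2]

/-- `‖u‖₁ ≤ a + 1/2` for a ground state of the window `[-a, a]` (`|u| ≤ (1 + |u|²)/2` on the window,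
`∫|u|² = 1`; adapted from `stub_supBound`). [folklore] -/
private theorem stub_edgeLaw_comparison_l1 {a : ℝ} {u : ℝ → ℂ} (hu : IsWeilGroundState a u)
    (hu0 : ∀ x, x ∉ Icc (-a) a → u x = 0) : ∫ x, ‖u x‖ ≤ a + 1 / 2 := by
  have ha := hu.pos
  have h2 : Integrable (fun x ↦ ‖u x‖ ^ 2) :=
    (memLp_two_iff_integrable_sq_norm hu.memLp.1).1 hu.memLp
  have hind : Integrable ((Icc (-a) a).indicator (fun _ ↦ (1 : ℝ))) :=
    (integrable_indicator_iff measurableSet_Icc).2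
      (integrableOn_const (by rw [Real.volume_Icc]; exact ENNReal.ofReal_ne_top))
  calc ∫ x, ‖u x‖ ≤ ∫ x, ((Icc (-a) a).indicator (fun _ ↦ (1 : ℝ)) x + ‖u x‖ ^ 2) / 2 := by
        refine integral_mono hu.integrable.norm ((hind.add h2).div_const 2) fun x ↦ ?_
        by_cases hx : x ∈ Icc (-a) a
        · dsimp only
          rw [indicator_of_mem hx]
          nlinarith [sq_nonneg (‖u x‖ - 1)]
        · simp [hu0 x hx, hx]
    _ = (volume.real (Icc (-a) a) + ∫ x, ‖u x‖ ^ 2) / 2 := by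
        rw [integral_div, integral_add hind h2, integral_indicator_const _ measurableSet_Icc,
          smul_eq_mul, mul_one]
    _ = a + 1 / 2 := by
        rw [hu.integral_norm_sq, Real.volume_real_Icc_of_le (by linarith)]
        ring

/-- **The weak maximum principle with the barrier, one phase.** Under (C2) and (EL), for a window
`a ∈ [b₀, A]`, `δ` with `2∫_{Ioi δ} ρ ≥ M_A + ε(b₀) + 1`, a barrier `B` (`0 ≤ B ≤ T⁻¹`, `= T⁻¹` on
the plateau `|x| ≤ a − d₀`, `= 0` off the window, finite energy, surplus `σ` on non-negative layer
functions) and a ground state `v` with `‖v‖ ≤ K₀` vanishing on `|x| ≥ a`: if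
`K₀ T σ ≥ 4e^{2A}(A + ½) + 2ρ(δ)(A + ½) + 2K₀ S_A + 1` then `Re v ≤ K₀ T B` a.e. (test (EL) against
`(Re v − K₀ T B)⁺`; arXiv:2010.10448 §3, arXiv:2401.18033 Thm 2.4). [folklore] -/
theorem stub_edgeLaw_comparison_phase
    (hC2 : ∀ (a : ℝ) (u : ℝ → ℂ), IsWeilGroundState a u →
      IntegrableOn (fun t ↦ weilArchDensity t * weilIncrement u t) (Ioi 0) ∧
        weilPoleForm u + weilDirichletEnergy a u ≤
          (weilMarkovConstant a + weilGroundEnergy a) * ∫ x, ‖u x‖ ^ 2)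
    (hEL : ∀ (a : ℝ) (u : ℝ → ℂ), IsWeilGroundState a u →
      ∀ w : ℝ → ℂ, MemLp w 2 → (∀ᵐ x : ℝ, x ∉ Icc (-a) a → w x = 0) →
        IntegrableOn (fun t ↦ weilArchDensity t * weilIncrement w t) (Ioi 0) →
        2 * (∫ x, u x * (Real.cosh (x / 2) : ℂ)) *
              (starRingEnd ℂ) (∫ x, w x * (Real.cosh (x / 2) : ℂ))
          - 2 * (∫ x, u x * (Real.sinh (x / 2) : ℂ)) *
              (starRingEnd ℂ) (∫ x, w x * (Real.sinh (x / 2) : ℂ))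
          + (∑ n ∈ weilPrimeIndex a,
              (((ArithmeticFunction.vonMangoldt n : ℝ) / Real.sqrt n : ℝ) : ℂ) *
                ∫ x, (u (x + Real.log n) - u x) * (starRingEnd ℂ) (w (x + Real.log n) - w x))
          + (∫ t in Ioi (0 : ℝ), (weilArchDensity t : ℂ) *
              ∫ x, (u (x + t) - u x) * (starRingEnd ℂ) (w (x + t) - w x))
          - (weilMarkovConstant a : ℂ) * ∫ x, u x * (starRingEnd ℂ) (w x)
        = (weilGroundEnergy a : ℂ) * ∫ x, u x * (starRingEnd ℂ) (w x))
    {b₀ A a δ d₀ K₀ T σ : ℝ} (hb₀ : 0 < b₀) (hba : b₀ ≤ a) (haA : a ≤ A) (hδ : 0 < δ)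
    (hκ : weilMarkovConstant A + weilGroundEnergy b₀ + 1 ≤ 2 * ∫ t in Ioi δ, weilArchDensity t)
    (hK₀ : 0 ≤ K₀) (hT : 0 < T)
    (hbig : 4 * Real.exp A ^ 2 * (A + 1 / 2) + 2 * (weilArchDensity δ * (A + 1 / 2)) +
        2 * K₀ * (∑ n ∈ weilPrimeIndex A,
          ((ArithmeticFunction.vonMangoldt n : ℝ) / Real.sqrt n)) + 1 ≤ K₀ * T * σ)
    {B : ℝ → ℝ} (hB01 : ∀ x, 0 ≤ B x ∧ B x ≤ T⁻¹) (hBout : ∀ x, a ≤ |x| → B x = 0)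
    (hBplat : ∀ x, |x| ≤ a - d₀ → B x = T⁻¹) (hBL2 : MemLp (fun x ↦ (B x : ℂ)) 2)
    (hBfin : IntegrableOn
      (fun t ↦ weilArchDensity t * weilIncrement (fun x ↦ (B x : ℂ)) t) (Ioi 0))
    (hSur : ∀ w : ℝ → ℝ, MemLp w 2 → (∀ x, 0 ≤ w x) →
        (∀ᵐ x : ℝ, ¬(a - d₀ < |x| ∧ |x| < a) → w x = 0) →
        IntegrableOn (fun t ↦ weilArchDensity t * weilIncrement (fun x ↦ (w x : ℂ)) t) (Ioi 0) →
        σ * ∫ x, w x ≤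
          ∫ t in Ioc (0 : ℝ) δ, weilArchDensity t * ∫ x, (B (x + t) - B x) * (w (x + t) - w x))
    {v : ℝ → ℂ} (hv : IsWeilGroundState a v) (hv0 : ∀ x, a ≤ |x| → v x = 0)
    (hvK : ∀ x, ‖v x‖ ≤ K₀) :
    ∀ᵐ x : ℝ, (v x).re ≤ K₀ * T * B x := by
  set N : ℝ := A + 1 / 2 with hN
  set K₁ : ℝ := K₀ * T with hK₁
  set S : ℝ := ∑ n ∈ weilPrimeIndex A, ((ArithmeticFunction.vonMangoldt n : ℝ) / Real.sqrt n)
  have hK₁0 : 0 ≤ K₁ := mul_nonneg hK₀ hT.le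
  have hK₁T : K₁ * T⁻¹ = K₀ := by rw [hK₁, mul_assoc, mul_inv_cancel₀ hT.ne', mul_one]
  have hρδ : 0 ≤ weilArchDensity δ := (weilArchDensity_pos hδ).le
  have hcn : ∀ n : ℕ, 0 ≤ (ArithmeticFunction.vonMangoldt n : ℝ) / Real.sqrt n := fun n ↦
    div_nonneg ArithmeticFunction.vonMangoldt_nonneg (Real.sqrt_nonneg _)
  have hIcc : ∀ x, x ∉ Icc (-a) a → a ≤ |x| := fun x hx ↦ by
    rw [mem_Icc, not_and_or, not_le, not_le] at hx
    rcases hx with h | h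
    · linarith [neg_le_abs x]
    · linarith [le_abs_self x]
  have hv0' : ∀ x, x ∉ Icc (-a) a → v x = 0 := fun x hx ↦ hv0 x (hIcc x hx)
  have hVle : ∀ x, (v x).re ≤ K₀ := fun x ↦ (Complex.re_le_norm _).trans (hvK x)
  -- the test function `W = (Re v − K₁ B)⁺`
  set W : ℝ → ℝ := fun x ↦ max ((v x).re - K₁ * B x) 0 with hW
  have hW0 : ∀ x, 0 ≤ W x := fun x ↦ le_max_right _ _
  have hWout : ∀ x, a ≤ |x| → W x = 0 := fun x hx ↦ by
    simp only [hW, hv0 x hx, hBout x hx, Complex.zero_re, mul_zero, sub_zero, max_self]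
  have hWplat : ∀ x, |x| ≤ a - d₀ → W x = 0 := fun x hx ↦ by
    simp only [hW, hBplat x hx, hK₁T]
    exact max_eq_right (by linarith [hVle x])
  have hWsupp : ∀ x, x ∉ Icc (-a) a → W x = 0 := fun x hx ↦ hWout x (hIcc x hx)
  have hWlayer : ∀ x, ¬(a - d₀ < |x| ∧ |x| < a) → W x = 0 := fun x hx ↦ by
    rcases not_and_or.1 hx with h | h
    · exact hWplat x (not_lt.1 h)
    · exact hWout x (not_lt.1 h)
  -- `W ∈ L²`: `W = Φ ∘ g`, `g = v − K₁ B`, `Φ = (Re ·)⁺`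
  have hh : MemLp (fun x ↦ (K₁ : ℂ) * (B x : ℂ)) 2 := hBL2.const_mul _
  have hgL2 : MemLp (fun x ↦ v x - (K₁ : ℂ) * (B x : ℂ)) 2 := hv.memLp.sub hh
  have hΦ := stub_edgeLaw_comparison_trunc
  have hWe : (fun x ↦ ((W x : ℝ) : ℂ)) =
      (fun z : ℂ ↦ ((max z.re 0 : ℝ) : ℂ)) ∘ (fun x ↦ v x - (K₁ : ℂ) * (B x : ℂ)) := by
    funext x
    simp only [hW, Function.comp_apply, Complex.sub_re, Complex.mul_re, Complex.ofReal_re,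
      Complex.ofReal_im, mul_zero, sub_zero]
  have hWC : MemLp (fun x ↦ ((W x : ℝ) : ℂ)) 2 := by
    rw [hWe]
    exact hΦ.comp_memLp (by simp) hgL2
  -- finite energy of `W`
  have hfinv := (hC2 a v hv).1
  have hfinh : IntegrableOn
      (fun t ↦ weilArchDensity t * weilIncrement (fun x ↦ (K₁ : ℂ) * (B x : ℂ)) t) (Ioi 0) := by
    simp_rw [stub_edgeLaw_comparison_incr_const_mul]
    exact (hBfin.const_mul (K₁ ^ 2)).congr (Eventually.of_forall fun t ↦ by ring)
  have hDle : ∀ t, weilIncrement (fun x ↦ ((W x : ℝ) : ℂ)) t ≤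
      3 * (weilIncrement v t + weilIncrement (fun x ↦ (K₁ : ℂ) * (B x : ℂ)) t) := fun t ↦ by
    have h1 : weilIncrement (fun x ↦ ((W x : ℝ) : ℂ)) t ≤
        weilIncrement (fun x ↦ v x - (K₁ : ℂ) * (B x : ℂ)) t := by
      rw [hWe]
      exact weilIncrement_comp_le hΦ (integrable_weilIncrement_integrand hgL2 t)
    have h2 := stub_localizedCut_weilIncrement_sub hv.memLp hh t
    have h3 := stub_localizedCut_norm_polar_le hv.memLp hh t
    have h4 := (Complex.abs_re_le_norm (∫ x, (v (x + t) - v x) *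
      conj ((K₁ : ℂ) * (B (x + t) : ℂ) - (K₁ : ℂ) * (B x : ℂ)))).trans h3
    rw [abs_le] at h4
    linarith [h4.1, weilIncrement_nonneg v t, weilIncrement_nonneg (fun x ↦ (K₁ : ℂ) * (B x : ℂ)) t]
  have hfinW : IntegrableOn
      (fun t ↦ weilArchDensity t * weilIncrement (fun x ↦ ((W x : ℝ) : ℂ)) t) (Ioi 0) := by
    refine Integrable.mono' ((hfinv.add hfinh).const_mul 3)
      (measurable_weilArchDensity.aestronglyMeasurable.mul
        (stub_supBound_aesm_weilIncrement hWC.1).restrict) ?_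
    refine (ae_restrict_iff' measurableSet_Ioi).2 (Eventually.of_forall fun t (ht : 0 < t) ↦ ?_)
    rw [Real.norm_of_nonneg (mul_nonneg (weilArchDensity_pos ht).le (weilIncrement_nonneg _ t))]
    have := mul_le_mul_of_nonneg_left (hDle t) (weilArchDensity_pos ht).le
    simp only [Pi.add_apply]
    linarith
  have hv1 : Integrable v := hv.integrable
  have hWC1 : Integrable (fun x ↦ ((W x : ℝ) : ℂ)) := by
    refine Integrable.mono' hv1.norm hWC.1 (Eventually.of_forall fun x ↦ ?_)
    rw [Complex.norm_real, Real.norm_of_nonneg (hW0 x)]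
    exact max_le (by linarith [Complex.re_le_norm (v x), mul_nonneg hK₁0 (hB01 x).1])
      (norm_nonneg _)
  have hW1 : Integrable W := by simpa using hWC1.re
  have hV : MemLp (fun x ↦ (v x).re) 2 := by simpa using hv.memLp.re
  have hWr : MemLp W 2 := by simpa using hWC.re
  have hBr : MemLp B 2 := by simpa using hBL2.re
  have hV1 : Integrable (fun x ↦ (v x).re) := by simpa using hv1.re
  have hmk : ∀ p q, K₁ * ((B p - B q) * (W p - W q)) ≤ ((v p).re - (v q).re) * (W p - W q) :=
    fun p q ↦ by
      have h : 0 ≤ (((v p).re - K₁ * B p) - ((v q).re - K₁ * B q)) * (W p - W q) :=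
        stub_edgeLaw_comparison_markov _ _
      linarith
  have hJV : ∀ t, K₁ * ∫ x, (B (x + t) - B x) * (W (x + t) - W x) ≤
      ∫ x, ((v (x + t)).re - (v x).re) * (W (x + t) - W x) := fun t ↦ by
    have hWt : MemLp (fun x ↦ W (x + t) - W x) 2 :=
      (hWr.comp_measurePreserving (measurePreserving_add_right volume t)).sub hWr
    have iB : Integrable (fun x ↦ (B (x + t) - B x) * (W (x + t) - W x)) :=
      ((hBr.comp_measurePreserving (measurePreserving_add_right volume t)).sub hBr).integrable_mul
        hWt
    have iV : Integrable (fun x ↦ ((v (x + t)).re - (v x).re) * (W (x + t) - W x)) :=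
      ((hV.comp_measurePreserving (measurePreserving_add_right volume t)).sub hV).integrable_mul
        hWt
    rw [← integral_const_mul]
    exact integral_mono (iB.const_mul K₁) iV fun x ↦ hmk _ _
  have hJ : ∀ t, -(2 * K₀ * ∫ x, W x) ≤
      ∫ x, ((v (x + t)).re - (v x).re) * (W (x + t) - W x) := fun t ↦ by
    have h1 := mul_le_mul_of_nonneg_left (stub_edgeLaw_comparison_cross_lower hBr hWr hW1
      (fun x ↦ (hB01 x).1) (fun x ↦ (hB01 x).2) hW0 t) hK₁0
    have e : K₁ * (2 * T⁻¹ * ∫ x, W x) = 2 * K₀ * ∫ x, W x := by rw [← hK₁T]; ring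
    linarith [hJV t]
  -- the Euler–Lagrange identity against `W`, real part
  have hWCsupp : ∀ᵐ x : ℝ, x ∉ Icc (-a) a → ((W x : ℝ) : ℂ) = 0 :=
    Eventually.of_forall fun x hx ↦ by rw [hWsupp x hx, Complex.ofReal_zero]
  have hid := hEL a v hv (fun x ↦ ((W x : ℝ) : ℂ)) hWC hWCsupp hfinW
  have hre := congrArg Complex.re hid
  simp only [Complex.sub_re, Complex.add_re, Complex.re_ofReal_mul] at hre
  have hpair : (∫ x, v x * conj ((W x : ℝ) : ℂ)).re = ∫ x, (v x).re * W x :=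
    stub_supBound_re_integral_mul_conj_ofReal (hv.memLp.integrable_mul hWC)
  rw [hpair] at hre
  have hpole := stub_edgeLaw_comparison_pole haA hv1 hv0' hWC1 hWsupp
  have hI0 : 0 ≤ ∫ x, W x := integral_nonneg hW0
  have hsum : -(2 * K₀ * ∫ x, W x) * S ≤ (∑ n ∈ weilPrimeIndex a,
      (((ArithmeticFunction.vonMangoldt n : ℝ) / Real.sqrt n : ℝ) : ℂ) *
        ∫ x, (v (x + Real.log n) - v x) *
          conj (((W (x + Real.log n) : ℝ) : ℂ) - ((W x : ℝ) : ℂ))).re := by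
    rw [Complex.re_sum]
    have hSa : ∑ n ∈ weilPrimeIndex a, ((ArithmeticFunction.vonMangoldt n : ℝ) / Real.sqrt n) ≤
        S := Finset.sum_le_sum_of_subset_of_nonneg (stub_supBound_weilPrimeIndex_mono haA)
          fun n _ _ ↦ hcn n
    have hI : -(2 * K₀ * ∫ x, W x) ≤ 0 := by have := mul_nonneg hK₀ hI0; linarith
    calc -(2 * K₀ * ∫ x, W x) * S
        ≤ -(2 * K₀ * ∫ x, W x) *
            ∑ n ∈ weilPrimeIndex a, ((ArithmeticFunction.vonMangoldt n : ℝ) / Real.sqrt n) :=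
          mul_le_mul_of_nonpos_left hSa hI
      _ = ∑ n ∈ weilPrimeIndex a, -(2 * K₀ * ∫ x, W x) *
            ((ArithmeticFunction.vonMangoldt n : ℝ) / Real.sqrt n) := Finset.mul_sum _ _ _
      _ ≤ _ := Finset.sum_le_sum fun n _ ↦ by
          rw [Complex.re_ofReal_mul, stub_supBound_re_crossIncrement hv.memLp hWC, mul_comm]
          exact mul_le_mul_of_nonneg_left (hJ _) (hcn n)
  -- the archimedean term: near part `≥ K₁ σ ∫ W`, far part expanded
  obtain ⟨hDint, harch⟩ := stub_supBound_arch_re hv.memLp hWC hfinv hfinW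
  obtain ⟨hDBint, -⟩ := stub_supBound_arch_re hBL2 hWC hBfin hfinW
  simp only [Complex.ofReal_re] at hDBint
  rw [harch] at hre
  have hsplit : ∫ t in Ioi (0 : ℝ), weilArchDensity t *
        ∫ x, ((v (x + t)).re - (v x).re) * (W (x + t) - W x) =
      (∫ t in Ioc (0 : ℝ) δ, weilArchDensity t *
          ∫ x, ((v (x + t)).re - (v x).re) * (W (x + t) - W x)) +
        ∫ t in Ioi δ, weilArchDensity t *
          ∫ x, ((v (x + t)).re - (v x).re) * (W (x + t) - W x) := by
    rw [← Ioc_union_Ioi_eq_Ioi hδ.le, setIntegral_union (Ioc_disjoint_Ioi le_rfl)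
      measurableSet_Ioi (hDint.mono_set Ioc_subset_Ioi_self)
      (hDint.mono_set (Ioi_subset_Ioi hδ.le))]
  rw [hsplit] at hre
  have hnear : K₁ * (σ * ∫ x, W x) ≤ ∫ t in Ioc (0 : ℝ) δ, weilArchDensity t *
      ∫ x, ((v (x + t)).re - (v x).re) * (W (x + t) - W x) := by
    have h1 := mul_le_mul_of_nonneg_left
      (hSur W hWr hW0 (Eventually.of_forall hWlayer) hfinW) hK₁0
    have h2 : ∫ t in Ioc (0 : ℝ) δ, K₁ * (weilArchDensity t *
          ∫ x, (B (x + t) - B x) * (W (x + t) - W x)) ≤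
        ∫ t in Ioc (0 : ℝ) δ, weilArchDensity t *
          ∫ x, ((v (x + t)).re - (v x).re) * (W (x + t) - W x) :=
      setIntegral_mono_on ((hDBint.mono_set Ioc_subset_Ioi_self).const_mul K₁)
        (hDint.mono_set Ioc_subset_Ioi_self) measurableSet_Ioc fun t ht ↦ by
          rw [mul_left_comm]
          exact mul_le_mul_of_nonneg_left (hJV t) (weilArchDensity_pos ht.1).le
    rw [integral_const_mul] at h2
    exact h1.trans h2
  have hfar := stub_supBound_far_lower hV hWr hV1 hW1 hδ
  -- the numbers
  have hNW : ∫ x, ‖((W x : ℝ) : ℂ)‖ = ∫ x, W x := integral_congr_ae (Eventually.of_forall fun x ↦ by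
    show ‖((W x : ℝ) : ℂ)‖ = W x
    rw [Complex.norm_real, Real.norm_of_nonneg (hW0 x)])
  have hNW' : ∫ x, |W x| = ∫ x, W x :=
    integral_congr_ae (Eventually.of_forall fun x ↦ abs_of_nonneg (hW0 x))
  have hNu : ∫ x, ‖v x‖ ≤ N :=
    (stub_edgeLaw_comparison_l1 hv hv0').trans (by rw [hN]; linarith)
  have hNv : ∫ x, |(v x).re| ≤ N :=
    (integral_mono hv1.re.abs hv1.norm fun x ↦ Complex.abs_re_le_norm (v x)).trans hNu
  have hVW0 : 0 ≤ ∫ x, (v x).re * W x := integral_nonneg fun x ↦ by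
    show 0 ≤ (v x).re * W x
    rcases le_total ((v x).re - K₁ * B x) 0 with h | h
    · rw [show W x = 0 from max_eq_right h, mul_zero]
    · rw [show W x = (v x).re - K₁ * B x from max_eq_left h]
      exact mul_nonneg ((mul_nonneg hK₁0 (hB01 x).1).trans (sub_nonneg.1 h)) h
  have hM : weilMarkovConstant a ≤ weilMarkovConstant A := stub_supBound_weilMarkovConstant_mono haA
  have hε : weilGroundEnergy a ≤ weilGroundEnergy b₀ := stub_supBound_weilGroundEnergy_anti hb₀ hba
  rw [hNW] at hpole; rw [hNW'] at hfar
  have hp1 : 4 * Real.exp A ^ 2 * (∫ x, ‖v x‖) * (∫ x, W x) ≤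
      4 * Real.exp A ^ 2 * N * ∫ x, W x :=
    mul_le_mul_of_nonneg_right (mul_le_mul_of_nonneg_left hNu (by positivity)) hI0
  have hp2 : 2 * (weilArchDensity δ * ((∫ x, |(v x).re|) * ∫ x, W x)) ≤
      2 * (weilArchDensity δ * (N * ∫ x, W x)) :=
    mul_le_mul_of_nonneg_left (mul_le_mul_of_nonneg_left
      (mul_le_mul_of_nonneg_right hNv hI0) hρδ) two_pos.le
  have hp3 : 0 ≤ (2 * (∫ t in Ioi δ, weilArchDensity t) - weilMarkovConstant a -
      weilGroundEnergy a - 1) * ∫ x, (v x).re * W x :=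
    mul_nonneg (by linarith) hVW0
  have hp4 := mul_le_mul_of_nonneg_right hbig hI0
  have hSz : ∫ x, W x = 0 := by
    apply le_antisymm _ hI0
    linarith [hre, hpole, hsum, hnear, hfar, hp1, hp2, hp3, hp4]
  -- conclusion
  have hWae : W =ᵐ[volume] 0 := (integral_eq_zero_iff_of_nonneg hW0 hW1).1 hSz
  filter_upwards [hWae] with x hx
  have hx' : max ((v x).re - K₁ * B x) 0 = 0 := hx
  linarith [le_max_left ((v x).re - K₁ * B x) 0]

end Summit.RiemannHypothesis.RiemannHypothesis.Theorems.WeilWindowFlowWindowLipschitz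

end
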